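import Summits.BirchSwinnertonDyer.BirchSwinnertonDyer.Theses.ThetaPartnerAtTwo
import HarnessLib

/-!
# Route `ThetaPartnerAtTwo`, crux K2 `SignedMainConjectureCMTwo` (item stmt-BirchSwinnertonDyer-20307):
# the route uses the crux ONLY at CM curves of analytic rank `0`

HONEST FRAMING (cell `pub/bsd-wall`, W-ALL row 1, prover seat `bsd-wall-tp2-p2`, successor g1): the
crux `Summit.BirchSwinnertonDyer.BirchSwinnertonDyer.Theses.ThetaPartnerAtTwo.SignedMainConjectureCMTwo`
quantifies over EVERY CM curve `A/ℚ` good supersingular at `2` with `a₂ = 0` — including the CM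
anchors of positive rank (121b1, 361a1, 1849a1, …: explicit non-torsion points, `L(A,1) = 0`), where
"`X⁺(A/ℚ_∞)` is `Λ`-torsion" is the `p = 2` analogue of Kobayashi Thm. 1.2 in positive rank
(Kato–Rohrlich non-vanishing input) and Kobayashi's `+` main conjecture has no `T = 0` anchor. The
route's deciding theorem `closes` (Theses file, rev 7) calls the crux only at the CM PARTNER `A` of the
habitat clause, which since rev 7 carries `A.analyticRank = 0`. This file records that fact in the
kernel:

* `nonCMAtTwo_of_signedMainConjectureCMTwo_rankZero` — the statement of `closes` with the crux
  REPLACED by its restriction to `A.analyticRank = 0` (verbatim the crux's body behind one extra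
  binder): PUB supports → K1 `SignedTransportAtTwo` → K2↾(r_an = 0) → K3 → K4 → residual →
  `NonCMAtTwo`. Same proof as `closes`, feeding `hAr : A.analyticRank = 0` to the restricted crux.
* `signedMainConjectureCMTwo_rankZero_of_signedMainConjectureCMTwo` — the crux implies its
  restriction (so the restriction is a WEAKER item with the same assembling power).

Consequence for the planner (not a route edit — author's pen): restating K2 with the binder
`A.analyticRank = 0 →` loses nothing for the route and removes the positive-rank CM curves, on which
nothing at `p = 2` is even reducible to a `T = 0` identity; at analytic rank `0` the sibling file
`ThetaPartnerAtTwoSignedMainConjectureCMTwoRankZero.lean` reduces the crux to ONE divisibility + Kim's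
control at `2` + torsion + the analytic `μ`. Nothing about any curve is asserted here; no item is
closed; the theorems are pure logic over the route's declarations and the tree door
`bsdp_two_of_kobayashiMainConjecture_two_of_frobeniusTrace_eq_zero`.

References: [Kobayashi2003] Thm. 1.2, Conjecture (p. 2); [BDKim2013] Cor. 3.15; [PollackRubin2004]
Thm. 7.3; [Sprung2017] Thm. 1.12 (Pollack pair at `2` needs `L(A,1) ≠ 0` in the tree:
`exists_isPollackPair_two`).
-/

set_option autoImplicit false
-- the Theorems namespace of this sub repeats the summit name by design (D-0017 nested layout)
set_option linter.dupNamespace false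

noncomputable section

open scoped Classical MatrixGroups ModularForm

open CongruenceSubgroup WeierstrassCurve Literature.NumberTheory.EllipticCurves
  Literature.NumberTheory.EllipticCurves.ModularForms
  Literature.NumberTheory.EllipticCurves.Rank1Residual
  Literature.NumberTheory.EllipticCurves.Kobayashi2003 ZpExtension
  Summit.BirchSwinnertonDyer.Rank1Residual Summit.BirchSwinnertonDyer.Rank1Residual.Supersingular

namespace Summit.BirchSwinnertonDyer.BirchSwinnertonDyer.Theorems

/-! ## The route uses the crux only at analytic rank `0` -/

section RankZeroSuffices

open Summit.BirchSwinnertonDyer.BirchSwinnertonDyer.Theses.ThetaPartnerAtTwo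

/-- **`closes` with the crux K2 restricted to analytic rank `0`.** The route's target
`NonCMAtTwo` (BSD₂ for every non-CM curve of analytic rank `≤ 1`) follows from the PUB supports
(`ModularParametrizationSupply`, `EntireLFunctionRat`, `RankEqAnalyticRankLeOne`), K1
`SignedTransportAtTwo`, K3 `SignedKatoDivisibilityUpToAtTwo`, K4 `SignedControlAtTwo`, the residual
`OffThetaHabitatAtTwo`, and — in place of K2 `SignedMainConjectureCMTwo` — its RESTRICTION `hCMr` to
CM curves with `A.analyticRank = 0` (the crux's body verbatim behind that binder). The proof is the
deciding theorem's, word for word, with `hAr : A.analyticRank = 0` (habitat clause, rev 7) passed to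
`hCMr`. Kernel certificate that the route consumes the crux only at rank-`0` CM partners; nothing
asserted. [cite: Kobayashi2003, Thm. 1.2 and Conjecture (p. 2)] [cite: BDKim2013, Cor. 3.15] -/
theorem nonCMAtTwo_of_signedMainConjectureCMTwo_rankZero
    (hmod : ModularParametrizationSupply) (hLrat : EntireLFunctionRat)
    (hGZK : RankEqAnalyticRankLeOne) (hT : SignedTransportAtTwo)
    (hCMr : ∀ (A : WeierstrassCurve ℚ) [A.IsElliptic] [A.IsGloballyMinimal],
      A.HasCM → A.analyticRank = 0 → GoodSS A 2 → A.frobeniusTrace 2 = 0 →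
      (∀ (κ : ZpExtension ℚ 2) (γ : Field.absoluteGaloisGroup ℚ),
        κ.IsCyclotomic → κ.IsTopGenerator γ →
        ∀ D : SignedSelmerDualData A κ γ 1, Module.IsTorsion (IwasawaAlgebra 2) D.X ∧ D.mu = 0) ∧
      KobayashiMainConjecture A 2 1)
    (hKato : SignedKatoDivisibilityUpToAtTwo) (hStr : SignedControlAtTwo) (hR : OffThetaHabitatAtTwo) :
    Summit.BirchSwinnertonDyer.BirchSwinnertonDyer.Rank1Residual.NonCMAtTwo := by
  intro W _ _ hcm hr1
  by_cases hH : (W.analyticRank = 0 ∧ GoodSS W 2 ∧ W.frobeniusTrace 2 = 0 ∧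
        ∃ (A : WeierstrassCurve ℚ) (_ : A.IsElliptic) (_ : A.IsGloballyMinimal),
          A.HasCM ∧ A.analyticRank = 0 ∧ GoodSS A 2 ∧ A.frobeniusTrace 2 = 0 ∧
            ∃ e : WeierstrassCurve.geomTorsion W (2 : ℤ) ≃+ WeierstrassCurve.geomTorsion A (2 : ℤ),
              ∀ (σ : Field.absoluteGaloisGroup ℚ) (P : WeierstrassCurve.geomTorsion W (2 : ℤ)),
                e (σ • P) = σ • e P)
  · obtain ⟨hr, hss, ha, A, iA, iA', hAcm, hAr, hAss, hAa, hcong⟩ := hH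
    have hL : W.entireLFunction 1 ≠ 0 := (W.analyticRank_eq_zero_iff_holds (hLrat W)).mp hr
    have hLA : A.entireLFunction 1 ≠ 0 := (A.analyticRank_eq_zero_iff_holds (hLrat A)).mp hAr
    haveI : NeZero (A.conductorNorm ℤ) := ⟨(A.conductorNorm_pos_holds).ne'⟩
    obtain ⟨DmA⟩ := hmod A
    obtain ⟨ϖA, hϖApos, hϖAeq, hΩApos⟩ := DmA.exists_rat_mul_realPeriodRat_eq_plusPeriod
    obtain ⟨LsA, LfA, hSPA, hPPA⟩ := exists_isPollackPair_two DmA.isNewformOf hAss.1 hAa hLA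
    obtain ⟨hmuA, hMCA⟩ := hCMr A hAcm hAr hAss hAa
    have hMC : KobayashiMainConjecture W 2 1 :=
      hT W A hcm hr hss ha hAcm hAss hAa hcong DmA.f DmA.isNewformOf ϖA hϖAeq LsA LfA hPPA hmuA hMCA
        (hKato W hcm hr hss ha)
    obtain ⟨h12, hKim⟩ := hStr W hcm hr hss ha
    exact bsdp_two_of_kobayashiMainConjecture_two_of_frobeniusTrace_eq_zero
      W hmod hGZK hss.1 ha hL h12 hKim hMC
  · exact hR W hcm hr1 hH

/-- The crux implies its rank-`0` restriction (drop the binder). [cite: PollackRubin2004, Thm. 7.3 (shape only)] -/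
theorem signedMainConjectureCMTwo_rankZero_of_signedMainConjectureCMTwo
    (h : SignedMainConjectureCMTwo) :
    ∀ (A : WeierstrassCurve ℚ) [A.IsElliptic] [A.IsGloballyMinimal],
      A.HasCM → A.analyticRank = 0 → GoodSS A 2 → A.frobeniusTrace 2 = 0 →
      (∀ (κ : ZpExtension ℚ 2) (γ : Field.absoluteGaloisGroup ℚ),
        κ.IsCyclotomic → κ.IsTopGenerator γ →
        ∀ D : SignedSelmerDualData A κ γ 1, Module.IsTorsion (IwasawaAlgebra 2) D.X ∧ D.mu = 0) ∧
      KobayashiMainConjecture A 2 1 :=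
  fun A _ _ hcm _ hss ha => h A hcm hss ha

end RankZeroSuffices

end Summit.BirchSwinnertonDyer.BirchSwinnertonDyer.Theorems

end
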